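import Literature.NumberTheory.Automorphic.ArchKirillovSignsGL2Real
import HarnessLib

/-!
# The Kirillov functions of a weight-one vector of `GL₂(K_∞)` along a real place: the first-order
# system and its `K`-Bessel solutions (Jacquet–Langlands (1970), §5, Lemma 5.13.1 / Thm. 5.15)

Topic `NumberTheory/Automorphic`; namespace `Literature.NumberTheory.Automorphic`. Theorems only (no
definition, no named fact, no instance). The real-place companion of `ArchKirillovBesselGL2Real` (weight
`0`) and `ArchKirillovLowestWeightGL2Real` (extremal weights) for the remaining case of the archimedean
Hecke theory of `GL₂`: a vector `v ∈ 𝒢` of WEIGHT ONE at a real place `w` (`τ(W) v = i v`,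
`W = X⁺ - X⁻`) in a representation with NO extremal weight in its `𝔨`-orbit — the odd principal series
`π(μ₁, μ₂)`, `μ₁μ₂⁻¹ = sgn |·|^{s}` (Jacquet–Langlands (1970), §5, case (ii) of Lemma 5.13.1 / Thm. 5.15
(ii); Bump (1997), §2.8: the Whittaker functions `W_{±1/2, ν}`). Notation as in `ArchKirillovODEGL2Real`:
`H₀ = E₀₀ ⊗ r_w`, `X± `, `L = (H₀ - H₁) - i(X⁺ + X⁻)`, `R = (H₀ - H₁) + i(X⁺ + X⁻)`, `f(y) = ℓ(τ(exp yH₀) v)`.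

* `hasDerivAt_apply_gardingAct_expGL_lowering` / `_raising` — **the first-order equations**
  `f' = ((μ+k)/2 + iθe^y) f + ½ g_L`, `f' = ((μ-k)/2 - iθe^y) f + ½ g_R` for a weight-`k` vector with
  central character `μ`, `g_L = ℓ(τ(exp yH₀) τ(L) v)`, `g_R = ℓ(τ(exp yH₀) τ(R) v)` (generalising
  `ArchKirillovLowestWeightGL2Real.hasDerivAt_apply_gardingAct_expGL_of_lowering`, where `τ(L) v = 0`);
* `raising_lowering_apply` — **`τ(R) τ(L) v = (2λ - μ² - k² + 2k) v`** for a weight-`k` Casimir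
  eigenvector (`C v = λ v`): `RL = 2C - Z² + W² - 2iW` in `U(𝔤𝔩₂)`;
* `rotGen_lowering_apply`, `center_lowering_apply` — `τ(L) v` has weight `k - 2` and the same central
  character;
* `exists_weightOne_combination_eq_besselMode` — MAIN: for `k = 1`, `τ` acting by contractions, `ℓ`
  continuous for the `U(𝔤)`-seminorms with `ℓ(τ(X⁺) u) = θ ℓ(u)`, `θ² = -a²` (`a > 0`), and `κ ≠ 0` with
  `4κ² = 2λ - μ² + 1`, the combination `h = f + (2κ)⁻¹ g_L` — the Kirillov function of
  `v + (2κ)⁻¹ τ(L) v` — is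

    `h(y) = c · e^{(μ+1)y/2} · besselMode a (i(κ - ½)) (e^y)`,   i.e. `2c u^{(μ+1)/2} √u K_{κ-1/2}(a u)`, `u = e^y`:

  the pair `(f, g_L)` solves the first-order system `f' = (α + iθe^y) f + ½ g_L`,
  `g_L' = (α - iθe^y) g_L + 2κ² f` (`α = (μ+1)/2`; the second equation is the raising equation of the
  weight `-1` vector `τ(L) v` together with `τ(R)τ(L) v = 4κ² v`), whence `h`, `j = f - (2κ)⁻¹ g_L` solve
  `h' = (α + κ) h + iθe^y j`, `j' = (α - κ) j + iθe^y h`, and ELIMINATING `j` gives the WEIGHT-ZERO equation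
  `2h'' - (2μ+4) h' + 2(1+α-κ)(α+κ) h + 2θ² e^{2y} h = 0` — no `e^y`-term — so that
  `WhittakerODEDecayingSolution.exists_eq_const_mul_exp_mul_besselMode_of_growth` applies (this is the
  identity `W_{1/2,ν}(2x) ∝ √x (K_{ν+1/2}(x) + K_{ν-1/2}(x))` proved through the differential system rather
  than through special functions); replacing `κ` by `-κ` gives the companion `f - (2κ)⁻¹ g_L ∝ √u K_{κ+1/2}`;
* `exists_weightOne_combination_eq_besselMode_and_mellin` — and the Mellin transform
  `∫₀^∞ h(log u) u^{S-1/2} du/u = 2c a^{-(S+(μ+1)/2)} 2^{S+(μ+1)/2-2} Γ(½(S + μ/2 + 1 - κ)) Γ(½(S + μ/2 + κ))`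
  (`integral_cpow_mul_besselMode`), a single product of two Gamma functions: with `μ = s₁ + s₂`,
  `κ - ½ = (s₁ - s₂)/2` this is `Γ_ℝ(S + s₁)Γ_ℝ(S + s₂ + 1)` up to an exponential — the `L`-factor
  `L(S, μ₁)L(S, μ₂)` of the odd principal series (Jacquet–Langlands (1970), Thm. 5.15 / Prop. 5.17).

## References

* H. Jacquet, R. P. Langlands, *Automorphic Forms on GL(2)*, LNM 114 (1970), §5: Lemma 5.13.1, Thm. 5.15,
  Prop. 5.17 (PDF pp. 120–131 of the held retypeset copy). [JacquetLanglands1970]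
* D. Bump, *Automorphic Forms and Representations*, CUP 1997, §2.8 (Whittaker models for `GL(2, ℝ)`,
  `W_{k/2, s-1/2}`). [Bump1997]
* A. W. Knapp, *Representation Theory of Semisimple Groups*, Princeton 1986, Ch. III §3. [Knapp1986]
-/

noncomputable section

open MeasureTheory Measure NumberField NumberField.InfinitePlace NumberField.mixedEmbedding IsDedekindDomain Set Filter
open scoped MatrixGroups Topology Classical

namespace Literature.NumberTheory.Automorphic

variable {K : Type} [Field K] [NumberField K]

-- as in `ArchGardingWhittaker`
set_option backward.isDefEq.respectTransparency false

/-! ### 1. Matrix identities of a real place -/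

section Letters

variable (w : {w : InfinitePlace K // IsReal w})

local notation "H₀" => Matrix.single (0 : Fin 2) (0 : Fin 2) ((Pi.single w 1, 0) : mixedSpace K)
local notation "H₁" => Matrix.single (1 : Fin 2) (1 : Fin 2) ((Pi.single w 1, 0) : mixedSpace K)
local notation "X⁺" => Matrix.single (0 : Fin 2) (1 : Fin 2) ((Pi.single w 1, 0) : mixedSpace K)
local notation "X⁻" => Matrix.single (1 : Fin 2) (0 : Fin 2) ((Pi.single w 1, 0) : mixedSpace K)

omit [NumberField K] in
/-- `[H₀ - H₁, X⁺ + X⁻] = 2 (X⁺ - X⁻)`. [folklore] -/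
theorem cartan_comm_xSum :
    (H₀ - H₁) * (X⁺ + X⁻) - (X⁺ + X⁻) * (H₀ - H₁) = (2 : ℝ) • (X⁺ - X⁻) := by
  simp only [sub_mul, mul_sub, add_mul, mul_add, Matrix.single_mul_single_same, realIdem_mul_self (K := K) w]
  repeat rw [Matrix.single_mul_single_of_ne (h := (by decide : (1 : Fin 2) ≠ 0))]
  repeat rw [Matrix.single_mul_single_of_ne (h := (by decide : (0 : Fin 2) ≠ 1))]
  module

omit [NumberField K] in
/-- `[X⁺ - X⁻, H₀ - H₁] = -2 (X⁺ + X⁻)`. [folklore] -/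
theorem rotGen_comm_cartan :
    (X⁺ - X⁻) * (H₀ - H₁) - (H₀ - H₁) * (X⁺ - X⁻) = (-2 : ℝ) • (X⁺ + X⁻) := by
  simp only [sub_mul, mul_sub, Matrix.single_mul_single_same, realIdem_mul_self (K := K) w]
  repeat rw [Matrix.single_mul_single_of_ne (h := (by decide : (1 : Fin 2) ≠ 0))]
  repeat rw [Matrix.single_mul_single_of_ne (h := (by decide : (0 : Fin 2) ≠ 1))]
  module

omit [NumberField K] in
/-- `[X⁺ - X⁻, X⁺ + X⁻] = 2 (H₀ - H₁)`. [folklore] -/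
theorem rotGen_comm_xSum :
    (X⁺ - X⁻) * (X⁺ + X⁻) - (X⁺ + X⁻) * (X⁺ - X⁻) = (2 : ℝ) • (H₀ - H₁) := by
  simp only [sub_mul, mul_sub, add_mul, mul_add, Matrix.single_mul_single_same, realIdem_mul_self (K := K) w]
  repeat rw [Matrix.single_mul_single_of_ne (h := (by decide : (1 : Fin 2) ≠ 0))]
  repeat rw [Matrix.single_mul_single_of_ne (h := (by decide : (0 : Fin 2) ≠ 1))]
  module

omit [NumberField K] in
/-- The centre `H₀ + H₁ = 1 ⊗ r_w` commutes with `H₀ - H₁` and `X⁺ + X⁻`. [folklore] -/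
theorem center_comm_cartan_xSum :
    (H₀ + H₁) * (H₀ - H₁) - (H₀ - H₁) * (H₀ + H₁) = 0 ∧ (H₀ + H₁) * (X⁺ + X⁻) - (X⁺ + X⁻) * (H₀ + H₁) = 0 := by
  refine ⟨?_, ?_⟩
  · simp only [sub_mul, mul_sub, add_mul, mul_add, Matrix.single_mul_single_same, realIdem_mul_self (K := K) w]
    repeat rw [Matrix.single_mul_single_of_ne (h := (by decide : (1 : Fin 2) ≠ 0))]
    repeat rw [Matrix.single_mul_single_of_ne (h := (by decide : (0 : Fin 2) ≠ 1))]
    module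
  · simp only [add_mul, mul_add, Matrix.single_mul_single_same, realIdem_mul_self (K := K) w]
    repeat rw [Matrix.single_mul_single_of_ne (h := (by decide : (1 : Fin 2) ≠ 0))]
    repeat rw [Matrix.single_mul_single_of_ne (h := (by decide : (0 : Fin 2) ≠ 1))]
    module

end Letters

/-! ### 2. Identities in `End(𝒢)`: `R`, `L`, weights and `R L` -/

section EndIdentities

variable {hcpt : isCompact_glFiniteIntegralLevel 2 K}
  {E : Type*} [NormedAddCommGroup E] [NormedSpace ℂ E] [CompleteSpace E]
  {τ : ContRepresentation ℂ (AutomorphyDatum.gl 2 K hcpt).arch.carrier E}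
  (hτ : τ.IsStronglyContinuous) (w : {w : InfinitePlace K // IsReal w})

local notation "H₀" => Matrix.single (0 : Fin 2) (0 : Fin 2) ((Pi.single w 1, 0) : mixedSpace K)
local notation "H₁" => Matrix.single (1 : Fin 2) (1 : Fin 2) ((Pi.single w 1, 0) : mixedSpace K)
local notation "X⁺" => Matrix.single (0 : Fin 2) (1 : Fin 2) ((Pi.single w 1, 0) : mixedSpace K)
local notation "X⁻" => Matrix.single (1 : Fin 2) (0 : Fin 2) ((Pi.single w 1, 0) : mixedSpace K)
local notation "D" => gardingEnd (hcpt := hcpt) (τ := τ) hτ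
local notation "A[" y "]" => gardingAct (hcpt := hcpt) (τ := τ) hτ (expGL ((y : ℝ) • H₀))
local notation "Lo" => (gardingEnd (hcpt := hcpt) (τ := τ) hτ (H₀ - H₁) - Complex.I • gardingEnd (hcpt := hcpt) (τ := τ) hτ (X⁺ + X⁻))
local notation "Ra" => (gardingEnd (hcpt := hcpt) (τ := τ) hτ (H₀ - H₁) + Complex.I • gardingEnd (hcpt := hcpt) (τ := τ) hτ (X⁺ + X⁻))

/-- `τ(H₀ - H₁) τ(X⁺ + X⁻) = τ(X⁺ + X⁻) τ(H₀ - H₁) + 2 τ(X⁺ - X⁻)`. [folklore] -/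
theorem gardingEnd_cartan_mul_xSum :
    D (H₀ - H₁) * D (X⁺ + X⁻) = D (X⁺ + X⁻) * D (H₀ - H₁) + (2 : ℂ) • D (X⁺ - X⁻) := by
  rw [gardingEnd_mul_eq hτ, cartan_comm_xSum, gardingEnd_smul, Complex.ofReal_ofNat]

/-- `τ(W) τ(L) = τ(L) τ(W) - 2i τ(L)`: `τ(L)` lowers the weight by `2`. [cite: Bump1997, §2.2] -/
theorem gardingEnd_rotGen_mul_lowering :
    D (X⁺ - X⁻) * Lo = Lo * D (X⁺ - X⁻) + (-2 * Complex.I) • Lo := by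
  have h1 : D (X⁺ - X⁻) * D (H₀ - H₁) = D (H₀ - H₁) * D (X⁺ - X⁻) + ((-2 : ℝ) : ℂ) • D (X⁺ + X⁻) := by
    rw [gardingEnd_mul_eq hτ, rotGen_comm_cartan, gardingEnd_smul]
  have h2 : D (X⁺ - X⁻) * D (X⁺ + X⁻) = D (X⁺ + X⁻) * D (X⁺ - X⁻) + ((2 : ℝ) : ℂ) • D (H₀ - H₁) := by
    rw [gardingEnd_mul_eq hτ, rotGen_comm_xSum, gardingEnd_smul]
  rw [mul_sub, mul_smul_comm, h1, h2]
  simp only [sub_mul, smul_mul_assoc, smul_add, smul_sub, smul_smul, Complex.ofReal_neg, Complex.ofReal_ofNat]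
  match_scalars <;> first | ring1 | linear_combination (-2 : ℂ) * Complex.I_sq

/-- `τ(W) τ(R) = τ(R) τ(W) + 2i τ(R)`: `τ(R)` raises the weight by `2`. [cite: Bump1997, §2.2] -/
theorem gardingEnd_rotGen_mul_raising :
    D (X⁺ - X⁻) * Ra = Ra * D (X⁺ - X⁻) + (2 * Complex.I) • Ra := by
  have h1 : D (X⁺ - X⁻) * D (H₀ - H₁) = D (H₀ - H₁) * D (X⁺ - X⁻) + ((-2 : ℝ) : ℂ) • D (X⁺ + X⁻) := by
    rw [gardingEnd_mul_eq hτ, rotGen_comm_cartan, gardingEnd_smul]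
  have h2 : D (X⁺ - X⁻) * D (X⁺ + X⁻) = D (X⁺ + X⁻) * D (X⁺ - X⁻) + ((2 : ℝ) : ℂ) • D (H₀ - H₁) := by
    rw [gardingEnd_mul_eq hτ, rotGen_comm_xSum, gardingEnd_smul]
  rw [mul_add, mul_smul_comm, h1, h2]
  simp only [add_mul, smul_mul_assoc, smul_add, smul_smul, Complex.ofReal_neg, Complex.ofReal_ofNat]
  match_scalars <;> first | ring1 | linear_combination (-2 : ℂ) * Complex.I_sq

/-- The centre `τ(H₀ + H₁)` commutes with `τ(L)` and `τ(R)`. [folklore] -/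
theorem gardingEnd_center_mul_lowering_raising :
    D (H₀ + H₁) * Lo = Lo * D (H₀ + H₁) ∧ D (H₀ + H₁) * Ra = Ra * D (H₀ + H₁) := by
  obtain ⟨hc1, hc2⟩ := center_comm_cartan_xSum (K := K) w
  have h1 : D (H₀ + H₁) * D (H₀ - H₁) = D (H₀ - H₁) * D (H₀ + H₁) := by
    rw [gardingEnd_mul_eq hτ, hc1, gardingEnd_zero, add_zero]
  have h2 : D (H₀ + H₁) * D (X⁺ + X⁻) = D (X⁺ + X⁻) * D (H₀ + H₁) := by
    rw [gardingEnd_mul_eq hτ, hc2, gardingEnd_zero, add_zero]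
  refine ⟨?_, ?_⟩
  · rw [mul_sub, mul_smul_comm, h1, h2, sub_mul, smul_mul_assoc]
  · rw [mul_add, mul_smul_comm, h1, h2, add_mul, smul_mul_assoc]

/-- **`τ(L) v` has weight `k - 2`**: `τ(W) τ(L) v = i(k - 2) τ(L) v` if `τ(W) v = ik v`. [cite: Bump1997, §2.2] -/
theorem rotGen_lowering_apply (k : ℂ) (v : archGardingSpace hcpt τ) (hW : D (X⁺ - X⁻) v = (Complex.I * k) • v) :
    D (X⁺ - X⁻) (Lo v) = (Complex.I * (k - 2)) • (Lo v) := by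
  have hop := gardingEnd_rotGen_mul_lowering (hcpt := hcpt) (τ := τ) hτ w
  set L : Module.End ℂ (archGardingSpace hcpt τ) := Lo with hLd
  have h := congrArg (fun T => T v) hop
  simp only [Module.End.mul_apply, LinearMap.add_apply, LinearMap.smul_apply] at h
  rw [h, hW, map_smul, ← add_smul]
  congr 1
  ring

/-- **`τ(R) v` has weight `k + 2`.** [cite: Bump1997, §2.2] -/
theorem rotGen_raising_apply (k : ℂ) (v : archGardingSpace hcpt τ) (hW : D (X⁺ - X⁻) v = (Complex.I * k) • v) :
    D (X⁺ - X⁻) (Ra v) = (Complex.I * (k + 2)) • (Ra v) := by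
  have hop := gardingEnd_rotGen_mul_raising (hcpt := hcpt) (τ := τ) hτ w
  set R : Module.End ℂ (archGardingSpace hcpt τ) := Ra with hRd
  have h := congrArg (fun T => T v) hop
  simp only [Module.End.mul_apply, LinearMap.add_apply, LinearMap.smul_apply] at h
  rw [h, hW, map_smul, ← add_smul]
  congr 1
  ring

/-- `τ(L) v`, `τ(R) v` have the same central character as `v`. [folklore] -/
theorem center_lowering_raising_apply (μ : ℂ) (v : archGardingSpace hcpt τ) (hZ : D H₀ v + D H₁ v = μ • v) :
    D H₀ (Lo v) + D H₁ (Lo v) = μ • (Lo v) ∧ D H₀ (Ra v) + D H₁ (Ra v) = μ • (Ra v) := by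
  obtain ⟨h1, h2⟩ := gardingEnd_center_mul_lowering_raising (hcpt := hcpt) (τ := τ) hτ w
  have hZ' : D (H₀ + H₁) v = μ • v := by rw [gardingEnd_add, LinearMap.add_apply, hZ]
  refine ⟨?_, ?_⟩
  · have h := congrArg (fun T => T v) h1
    simp only [Module.End.mul_apply] at h
    rw [← LinearMap.add_apply, ← gardingEnd_add, h, hZ', map_smul]
  · have h := congrArg (fun T => T v) h2
    simp only [Module.End.mul_apply] at h
    rw [← LinearMap.add_apply, ← gardingEnd_add, h, hZ', map_smul]

/-- **`τ(R) τ(L) v = (2λ - μ² - k² + 2k) v`** for a weight-`k` vector with central character `μ` and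
Casimir eigenvalue `λ`: `RL = (H₀-H₁)² + (X⁺+X⁻)² - i[H₀-H₁, X⁺+X⁻] = 2C - Z² + W² - 2iW` in `U(𝔤𝔩₂)`
(Bump (1997), §2.2: `-4Δ = H² + 2RL + 2LR`, `[R, L] = H`-type identities). [cite: Bump1997, §2.2] -/
theorem raising_lowering_apply (k μ lam : ℂ) (v : archGardingSpace hcpt τ)
    (hW : D (X⁺ - X⁻) v = (Complex.I * k) • v) (hZ : D H₀ v + D H₁ v = μ • v)
    (hC : ∑ i : Fin 2, ∑ j : Fin 2, D (Matrix.single i j ((Pi.single w 1, 0) : mixedSpace K))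
        (D (Matrix.single j i ((Pi.single w 1, 0) : mixedSpace K)) v) = lam • v) :
    Ra (Lo v) = (2 * lam - μ ^ 2 - k ^ 2 + 2 * k) • v := by
  have hbr := gardingEnd_cartan_mul_xSum (hcpt := hcpt) (τ := τ) hτ w
  have hcomm : D H₁ * D H₀ = D H₀ * D H₁ := gardingEnd_hOne_mul_hZero hτ w
  rw [Fin.sum_univ_two, Fin.sum_univ_two, Fin.sum_univ_two] at hC
  rw [gardingEnd_sub, gardingEnd_add] at hbr ⊢
  rw [gardingEnd_sub] at hW hbr
  -- atoms
  set H0 : Module.End ℂ (archGardingSpace hcpt τ) := D H₀ with hH0d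
  set H1 : Module.End ℂ (archGardingSpace hcpt τ) := D H₁ with hH1d
  set Xp : Module.End ℂ (archGardingSpace hcpt τ) := D X⁺ with hXpd
  set Xm : Module.End ℂ (archGardingSpace hcpt τ) := D X⁻ with hXmd
  -- `hC : H0 (H0 v) + Xp (Xm v) + (Xm (Xp v) + H1 (H1 v)) = lam • v`
  have hH1 : H1 v = μ • v - H0 v := by rw [← hZ]; abel
  have hc : H1 (H0 v) = H0 (H1 v) := by
    have h := congrArg (fun T => T v) hcomm
    simpa only [Module.End.mul_apply] using h
  have hH1sq : H1 (H1 v) = (μ ^ 2) • v - (2 * μ) • H0 v + H0 (H0 v) := by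
    conv_lhs => rw [hH1]
    rw [map_sub, map_smul, hH1, hc, hH1, map_sub, map_smul, smul_sub, pow_two, mul_smul, two_mul, add_smul]
    abel
  -- `a = H0 - H1`, `b = Xp + Xm`
  have hW' : Xp v - Xm v = (Complex.I * k) • v := by rw [← hW, LinearMap.sub_apply]
  have hav : (H0 - H1) v = (2 : ℂ) • H0 v - μ • v := by rw [LinearMap.sub_apply, hH1, two_smul]; abel
  have haav : (H0 - H1) ((H0 - H1) v) = (4 : ℂ) • H0 (H0 v) - (4 * μ) • H0 v + (μ ^ 2) • v := by
    rw [hav, map_sub, map_smul, map_smul, hav, LinearMap.sub_apply, hc, hH1, map_sub, map_smul]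
    module
  have hWv : (Xp - Xm) v = (Complex.I * k) • v := by rw [LinearMap.sub_apply, hW']
  have hWW : Xp (Xp v) - Xm (Xp v) - (Xp (Xm v) - Xm (Xm v)) = (Complex.I * k * (Complex.I * k)) • v := by
    have h : (Xp - Xm) ((Xp - Xm) v) = (Complex.I * k * (Complex.I * k)) • v := by
      rw [hWv, map_smul, hWv, smul_smul]
    simpa only [LinearMap.sub_apply, map_sub] using h
  have hbbv : (Xp + Xm) ((Xp + Xm) v) = (Complex.I * k * (Complex.I * k)) • v +
      (2 : ℂ) • (lam • v - H0 (H0 v) - H1 (H1 v)) := by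
    have hcas : Xp (Xm v) + Xm (Xp v) = lam • v - H0 (H0 v) - H1 (H1 v) := by rw [← hC]; abel
    simp only [LinearMap.add_apply, map_add]
    have e : Xp (Xp v) + Xm (Xp v) + (Xp (Xm v) + Xm (Xm v)) =
        (Xp (Xp v) - Xm (Xp v) - (Xp (Xm v) - Xm (Xm v))) + (2 : ℂ) • (Xp (Xm v) + Xm (Xp v)) := by module
    rw [e, hWW, hcas]
  -- the bracket on `v`
  have hbrv : (H0 - H1) ((Xp + Xm) v) = (Xp + Xm) ((H0 - H1) v) + (2 : ℂ) • (Xp v - Xm v) := by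
    have h := congrArg (fun T => T v) hbr
    simp only [Module.End.mul_apply, LinearMap.add_apply, LinearMap.smul_apply, LinearMap.sub_apply] at h ⊢
    rw [h]
  -- expand `R (L v)`
  have hexp : (H0 - H1 + Complex.I • (Xp + Xm)) ((H0 - H1 - Complex.I • (Xp + Xm)) v) =
      (H0 - H1) ((H0 - H1) v) + (Xp + Xm) ((Xp + Xm) v) -
        Complex.I • ((H0 - H1) ((Xp + Xm) v) - (Xp + Xm) ((H0 - H1) v)) := by
    have hI : Complex.I * Complex.I = -1 := Complex.I_mul_I
    simp only [LinearMap.add_apply, LinearMap.sub_apply, LinearMap.smul_apply, map_sub, map_add, map_smul,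
      smul_sub, smul_add, smul_smul, hI, neg_smul, one_smul]
    abel
  rw [hexp, hbrv, haav, hbbv, hH1sq, hW']
  have hIk : Complex.I * k * (Complex.I * k) = -k ^ 2 := by
    have hI := Complex.I_sq
    linear_combination k ^ 2 * hI
  have hI2 : Complex.I * (2 * (Complex.I * k)) = -(2 * k) := by
    have hI := Complex.I_sq
    linear_combination (2 * k) * hI
  simp only [smul_sub, smul_add, smul_smul, hIk, hI2, add_sub_cancel_left]
  module

/-- **`τ(L) τ(R) v = (2λ - μ² - k² - 2k) v`** for a weight-`k` vector (the companion of
`raising_lowering_apply`: `LR = (H₀-H₁)² + (X⁺+X⁻)² + i[H₀-H₁, X⁺+X⁻]`). [cite: Bump1997, §2.2] -/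
theorem lowering_raising_apply (k μ lam : ℂ) (v : archGardingSpace hcpt τ)
    (hW : D (X⁺ - X⁻) v = (Complex.I * k) • v) (hZ : D H₀ v + D H₁ v = μ • v)
    (hC : ∑ i : Fin 2, ∑ j : Fin 2, D (Matrix.single i j ((Pi.single w 1, 0) : mixedSpace K))
        (D (Matrix.single j i ((Pi.single w 1, 0) : mixedSpace K)) v) = lam • v) :
    Lo (Ra v) = (2 * lam - μ ^ 2 - k ^ 2 - 2 * k) • v := by
  have hbr := gardingEnd_cartan_mul_xSum (hcpt := hcpt) (τ := τ) hτ w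
  have hcomm : D H₁ * D H₀ = D H₀ * D H₁ := gardingEnd_hOne_mul_hZero hτ w
  rw [Fin.sum_univ_two, Fin.sum_univ_two, Fin.sum_univ_two] at hC
  rw [gardingEnd_sub, gardingEnd_add] at hbr ⊢
  rw [gardingEnd_sub] at hW hbr
  -- atoms
  set H0 : Module.End ℂ (archGardingSpace hcpt τ) := D H₀ with hH0d
  set H1 : Module.End ℂ (archGardingSpace hcpt τ) := D H₁ with hH1d
  set Xp : Module.End ℂ (archGardingSpace hcpt τ) := D X⁺ with hXpd
  set Xm : Module.End ℂ (archGardingSpace hcpt τ) := D X⁻ with hXmd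
  -- `hC : H0 (H0 v) + Xp (Xm v) + (Xm (Xp v) + H1 (H1 v)) = lam • v`
  have hH1 : H1 v = μ • v - H0 v := by rw [← hZ]; abel
  have hc : H1 (H0 v) = H0 (H1 v) := by
    have h := congrArg (fun T => T v) hcomm
    simpa only [Module.End.mul_apply] using h
  have hH1sq : H1 (H1 v) = (μ ^ 2) • v - (2 * μ) • H0 v + H0 (H0 v) := by
    conv_lhs => rw [hH1]
    rw [map_sub, map_smul, hH1, hc, hH1, map_sub, map_smul, smul_sub, pow_two, mul_smul, two_mul, add_smul]
    abel
  -- `a = H0 - H1`, `b = Xp + Xm`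
  have hW' : Xp v - Xm v = (Complex.I * k) • v := by rw [← hW, LinearMap.sub_apply]
  have hav : (H0 - H1) v = (2 : ℂ) • H0 v - μ • v := by rw [LinearMap.sub_apply, hH1, two_smul]; abel
  have haav : (H0 - H1) ((H0 - H1) v) = (4 : ℂ) • H0 (H0 v) - (4 * μ) • H0 v + (μ ^ 2) • v := by
    rw [hav, map_sub, map_smul, map_smul, hav, LinearMap.sub_apply, hc, hH1, map_sub, map_smul]
    module
  have hWv : (Xp - Xm) v = (Complex.I * k) • v := by rw [LinearMap.sub_apply, hW']
  have hWW : Xp (Xp v) - Xm (Xp v) - (Xp (Xm v) - Xm (Xm v)) = (Complex.I * k * (Complex.I * k)) • v := by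
    have h : (Xp - Xm) ((Xp - Xm) v) = (Complex.I * k * (Complex.I * k)) • v := by
      rw [hWv, map_smul, hWv, smul_smul]
    simpa only [LinearMap.sub_apply, map_sub] using h
  have hbbv : (Xp + Xm) ((Xp + Xm) v) = (Complex.I * k * (Complex.I * k)) • v +
      (2 : ℂ) • (lam • v - H0 (H0 v) - H1 (H1 v)) := by
    have hcas : Xp (Xm v) + Xm (Xp v) = lam • v - H0 (H0 v) - H1 (H1 v) := by rw [← hC]; abel
    simp only [LinearMap.add_apply, map_add]
    have e : Xp (Xp v) + Xm (Xp v) + (Xp (Xm v) + Xm (Xm v)) =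
        (Xp (Xp v) - Xm (Xp v) - (Xp (Xm v) - Xm (Xm v))) + (2 : ℂ) • (Xp (Xm v) + Xm (Xp v)) := by module
    rw [e, hWW, hcas]
  -- the bracket on `v`
  have hbrv : (H0 - H1) ((Xp + Xm) v) = (Xp + Xm) ((H0 - H1) v) + (2 : ℂ) • (Xp v - Xm v) := by
    have h := congrArg (fun T => T v) hbr
    simp only [Module.End.mul_apply, LinearMap.add_apply, LinearMap.smul_apply, LinearMap.sub_apply] at h ⊢
    rw [h]
  -- expand `L (R v)`
  have hexp : (H0 - H1 - Complex.I • (Xp + Xm)) ((H0 - H1 + Complex.I • (Xp + Xm)) v) =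
      (H0 - H1) ((H0 - H1) v) + (Xp + Xm) ((Xp + Xm) v) +
        Complex.I • ((H0 - H1) ((Xp + Xm) v) - (Xp + Xm) ((H0 - H1) v)) := by
    have hI : Complex.I * Complex.I = -1 := Complex.I_mul_I
    simp only [LinearMap.add_apply, LinearMap.sub_apply, LinearMap.smul_apply, map_sub, map_add, map_smul,
      smul_sub, smul_add, smul_smul, hI, neg_smul, one_smul]
    abel
  rw [hexp, hbrv, haav, hbbv, hH1sq, hW']
  have hIk : Complex.I * k * (Complex.I * k) = -k ^ 2 := by
    have hI := Complex.I_sq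
    linear_combination k ^ 2 * hI
  have hI2 : Complex.I * (2 * (Complex.I * k)) = -(2 * k) := by
    have hI := Complex.I_sq
    linear_combination (2 * k) * hI
  simp only [smul_sub, smul_add, smul_smul, hIk, hI2, add_sub_cancel_left]
  module

/-! #### The sign `δ_w` and the weight-one combination -/

variable {δ : GL (Fin 2) (mixedSpace K)}
  (hδ : (δ : Matrix (Fin 2) (Fin 2) (mixedSpace K)) = 1 - (2 : ℝ) • Matrix.single (0 : Fin 2) (0 : Fin 2) ((Pi.single w 1, 0) : mixedSpace K))
include hδ

/-- **`τ(δ) τ(L) = τ(R) τ(δ)`** and **`τ(δ) τ(R) = τ(L) τ(δ)`**: the sign `δ_w` exchanges the lowering and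
raising operators. [cite: Knapp1986, Ch. III §3, Prop. 3.9] -/
theorem gardingAct_realSign_mul_lowering_raising :
    gardingAct hτ δ * Lo = Ra * gardingAct hτ δ ∧ gardingAct hτ δ * Ra = Lo * gardingAct hτ δ := by
  obtain ⟨h1, h2, h3, h4⟩ := gardingAct_realSign_mul_letters hτ hδ
  have ha : gardingAct hτ δ * D (H₀ - H₁) = D (H₀ - H₁) * gardingAct hτ δ := by
    rw [gardingEnd_sub, mul_sub, sub_mul, h1, h2]
  have hb : gardingAct hτ δ * D (X⁺ + X⁻) = (-1 : ℂ) • (D (X⁺ + X⁻) * gardingAct hτ δ) := by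
    rw [gardingEnd_add, mul_add, add_mul, h3, h4, smul_add]
  refine ⟨?_, ?_⟩
  · rw [mul_sub, mul_smul_comm, ha, hb, add_mul, smul_mul_assoc, smul_smul]
    norm_num
  · rw [mul_add, mul_smul_comm, ha, hb, sub_mul, smul_mul_assoc, smul_smul, mul_neg_one, neg_smul]
    exact (sub_eq_add_neg _ _).symm

/-- **The `δ_w`-translate of the weight-one combination is the companion weight-one combination**:
for a weight-one vector `v` with `τ(R)τ(L) v = 4κ² v` (so that `τ(L)τ(R) (τ(δ)v) = 4κ² τ(δ) v`,
`lowering_raising_apply` with weight `-1`), `τ(δ)(v + (2κ)⁻¹ τ(L) v) = (2κ)⁻¹ (v' + (2κ)⁻¹ τ(L) v')`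
with the weight-one vector `v' = τ(R) τ(δ) v` — so that the Kirillov function of `v + (2κ)⁻¹ τ(L) v`
on the negative half-line is `(2κ)⁻¹` times that of `v' + (2κ)⁻¹ τ(L) v'` on the positive half-line,
again `exists_weightOne_combination_eq_besselMode` with the same `κ`. [cite: JacquetLanglands1970, §5, Thm. 5.15] -/
theorem realSign_weightOne_combination (κ : ℂ) (hκ0 : κ ≠ 0) (v : archGardingSpace hcpt τ)
    (hLR : Lo (Ra (gardingAct hτ δ v)) = ((2 * κ) ^ 2) • gardingAct hτ δ v) :
    gardingAct hτ δ (v + (1 / (2 * κ)) • Lo v) =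
      (1 / (2 * κ)) • (Ra (gardingAct hτ δ v) + (1 / (2 * κ)) • Lo (Ra (gardingAct hτ δ v))) := by
  obtain ⟨hl, -⟩ := gardingAct_realSign_mul_lowering_raising hτ w hδ
  have h := congrArg (fun T => T v) hl
  simp only [Module.End.mul_apply] at h
  rw [map_add, map_smul, h, hLR, smul_add, smul_smul, smul_smul]
  have e : 1 / (2 * κ) * (1 / (2 * κ)) * (2 * κ) ^ 2 = 1 := by field_simp
  rw [e, one_smul, add_comm]

end EndIdentities

/-! ### 3. The first-order equations and the weight-one Bessel functions -/

section ODE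

variable {hcpt : isCompact_glFiniteIntegralLevel 2 K}
  {E : Type*} [NormedAddCommGroup E] [NormedSpace ℂ E] [CompleteSpace E]
  {τ : ContRepresentation ℂ (AutomorphyDatum.gl 2 K hcpt).arch.carrier E}
  (hτ : τ.IsStronglyContinuous) (w : {w : InfinitePlace K // IsReal w})

local notation "H₀" => Matrix.single (0 : Fin 2) (0 : Fin 2) ((Pi.single w 1, 0) : mixedSpace K)
local notation "H₁" => Matrix.single (1 : Fin 2) (1 : Fin 2) ((Pi.single w 1, 0) : mixedSpace K)
local notation "X⁺" => Matrix.single (0 : Fin 2) (1 : Fin 2) ((Pi.single w 1, 0) : mixedSpace K)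
local notation "X⁻" => Matrix.single (1 : Fin 2) (0 : Fin 2) ((Pi.single w 1, 0) : mixedSpace K)
local notation "D" => gardingEnd (hcpt := hcpt) (τ := τ) hτ
local notation "A[" y "]" => gardingAct (hcpt := hcpt) (τ := τ) hτ (expGL ((y : ℝ) • H₀))
local notation "Lo" => (gardingEnd (hcpt := hcpt) (τ := τ) hτ (H₀ - H₁) - Complex.I • gardingEnd (hcpt := hcpt) (τ := τ) hτ (X⁺ + X⁻))
local notation "Ra" => (gardingEnd (hcpt := hcpt) (τ := τ) hτ (H₀ - H₁) + Complex.I • gardingEnd (hcpt := hcpt) (τ := τ) hτ (X⁺ + X⁻))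

/-- **The lowering first-order equation**: `f' = ((μ+k)/2 + iθe^y) f + ½ ℓ(τ(exp yH₀) τ(L) v)` for a
weight-`k` vector with central character `μ` (`ArchKirillovLowestWeightGL2Real.hasDerivAt_apply_gardingAct_expGL_of_lowering`
is the case `τ(L) v = 0`). [cite: JacquetLanglands1970, §5, Lemma 5.13.1] [cite: Bump1997, §2.2 and §2.8] -/
theorem hasDerivAt_apply_gardingAct_expGL_lowering {ℓ : archGardingSpace hcpt τ →ₗ[ℂ] ℂ}
    (hℓ : ∃ (C : ℝ) (𝒮 : Finset (List (Matrix (Fin 2) (Fin 2) (mixedSpace K)))), 0 ≤ C ∧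
      ∀ v : archGardingSpace hcpt τ, ‖ℓ v‖ ≤ C * ∑ w ∈ 𝒮, ‖archWordDerivE hcpt τ w v‖)
    {θ : ℂ} (hθ : ∀ u : archGardingSpace hcpt τ, ℓ (D X⁺ u) = θ * ℓ u)
    (k μ : ℂ) (v : archGardingSpace hcpt τ)
    (hW : D (X⁺ - X⁻) v = (Complex.I * k) • v) (hZ : D H₀ v + D H₁ v = μ • v) (y : ℝ) :
    HasDerivAt (fun x : ℝ => ℓ (A[x] v))
      (((μ + k) / 2 + Complex.I * θ * (Real.exp y : ℂ)) * ℓ (A[y] v) + (1 / 2) * ℓ (A[y] (Lo v))) y := by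
  have hd := hasDerivAt_apply_gardingAct_expGL hτ w hℓ v y
  convert hd using 1
  have h1 : ℓ (A[y] (Lo v)) = ℓ (A[y] (D H₀ v)) - ℓ (A[y] (D H₁ v)) -
      Complex.I * (ℓ (A[y] (D X⁺ v)) + ℓ (A[y] (D X⁻ v))) := by
    simp only [gardingEnd_sub, gardingEnd_add, LinearMap.sub_apply, LinearMap.add_apply, LinearMap.smul_apply,
      map_sub, map_add, map_smul, smul_eq_mul]
  have h2 := congrArg (fun u : archGardingSpace hcpt τ => ℓ (A[y] u)) hZ
  have h3 := congrArg (fun u : archGardingSpace hcpt τ => ℓ (A[y] u)) hW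
  simp only [gardingEnd_sub, LinearMap.sub_apply, map_sub, map_add, map_smul, smul_eq_mul] at h2 h3
  have hX := apply_gardingAct_expGL_xPlus hτ w hθ v y
  linear_combination (1 / 2 : ℂ) * h1 - (1 / 2 : ℂ) * h2 + (Complex.I / 2) * h3 - Complex.I * hX +
    (k * ℓ (A[y] v) / 2) * Complex.I_sq

/-- **The raising first-order equation**: `f' = ((μ-k)/2 - iθe^y) f + ½ ℓ(τ(exp yH₀) τ(R) v)`.
[cite: JacquetLanglands1970, §5, Lemma 5.13.1] [cite: Bump1997, §2.2 and §2.8] -/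
theorem hasDerivAt_apply_gardingAct_expGL_raising {ℓ : archGardingSpace hcpt τ →ₗ[ℂ] ℂ}
    (hℓ : ∃ (C : ℝ) (𝒮 : Finset (List (Matrix (Fin 2) (Fin 2) (mixedSpace K)))), 0 ≤ C ∧
      ∀ v : archGardingSpace hcpt τ, ‖ℓ v‖ ≤ C * ∑ w ∈ 𝒮, ‖archWordDerivE hcpt τ w v‖)
    {θ : ℂ} (hθ : ∀ u : archGardingSpace hcpt τ, ℓ (D X⁺ u) = θ * ℓ u)
    (k μ : ℂ) (v : archGardingSpace hcpt τ)
    (hW : D (X⁺ - X⁻) v = (Complex.I * k) • v) (hZ : D H₀ v + D H₁ v = μ • v) (y : ℝ) :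
    HasDerivAt (fun x : ℝ => ℓ (A[x] v))
      (((μ - k) / 2 - Complex.I * θ * (Real.exp y : ℂ)) * ℓ (A[y] v) + (1 / 2) * ℓ (A[y] (Ra v))) y := by
  have hd := hasDerivAt_apply_gardingAct_expGL hτ w hℓ v y
  convert hd using 1
  have h1 : ℓ (A[y] (Ra v)) = ℓ (A[y] (D H₀ v)) - ℓ (A[y] (D H₁ v)) +
      Complex.I * (ℓ (A[y] (D X⁺ v)) + ℓ (A[y] (D X⁻ v))) := by
    simp only [gardingEnd_sub, gardingEnd_add, LinearMap.sub_apply, LinearMap.add_apply, LinearMap.smul_apply,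
      map_sub, map_add, map_smul, smul_eq_mul]
  have h2 := congrArg (fun u : archGardingSpace hcpt τ => ℓ (A[y] u)) hZ
  have h3 := congrArg (fun u : archGardingSpace hcpt τ => ℓ (A[y] u)) hW
  simp only [gardingEnd_sub, LinearMap.sub_apply, map_sub, map_add, map_smul, smul_eq_mul] at h2 h3
  have hX := apply_gardingAct_expGL_xPlus hτ w hθ v y
  linear_combination (1 / 2 : ℂ) * h1 - (1 / 2 : ℂ) * h2 - (Complex.I / 2) * h3 + Complex.I * hX -
    (k * ℓ (A[y] v) / 2) * Complex.I_sq

/-- **The weight-one Kirillov functions along a real place are `K`-Bessel functions of half-integrally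
shifted order** (Jacquet–Langlands (1970), Lemma 5.13.1 / Thm. 5.15 (ii), odd principal series; Bump
(1997), §2.8, `W_{±1/2,ν}`). For a weight-one vector `v` (`τ(W) v = i v`) with central character `μ` and
Casimir eigenvalue `λ`, and `κ ≠ 0` with `4κ² = 2λ - μ² + 1` (`= ` the scalar by which `τ(R)τ(L)` acts on
`v`), the Kirillov function of `v + (2κ)⁻¹ τ(L) v` along `exp(yH₀)` is
`c · e^{(μ+1)y/2} · besselMode a (i(κ - ½)) (e^y)` (see the module docstring for the proof through the
first-order system). Replacing `κ` by `-κ` gives the companion combination. [cite: JacquetLanglands1970, §5, Lemma 5.13.1 and Thm. 5.15]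
[cite: Bump1997, §2.8] -/
theorem exists_weightOne_combination_eq_besselMode (hτb : ∀ g, ‖(τ g : E →L[ℂ] E)‖ ≤ 1)
    {ℓ : archGardingSpace hcpt τ →ₗ[ℂ] ℂ}
    (hℓ : ∃ (C : ℝ) (𝒮 : Finset (List (Matrix (Fin 2) (Fin 2) (mixedSpace K)))), 0 ≤ C ∧
      ∀ v : archGardingSpace hcpt τ, ‖ℓ v‖ ≤ C * ∑ w ∈ 𝒮, ‖archWordDerivE hcpt τ w v‖)
    {θ : ℂ} (hθ : ∀ u : archGardingSpace hcpt τ, ℓ (D X⁺ u) = θ * ℓ u)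
    {a : ℝ} (ha : 0 < a) (hθa : θ ^ 2 = -((a : ℂ) ^ 2))
    (μ lam κ : ℂ) (hκ : (2 * κ) ^ 2 = 2 * lam - μ ^ 2 + 1) (hκ0 : κ ≠ 0) (v : archGardingSpace hcpt τ)
    (hW : D (X⁺ - X⁻) v = Complex.I • v) (hZ : D H₀ v + D H₁ v = μ • v)
    (hC : ∑ i : Fin 2, ∑ j : Fin 2, D (Matrix.single i j ((Pi.single w 1, 0) : mixedSpace K))
        (D (Matrix.single j i ((Pi.single w 1, 0) : mixedSpace K)) v) = lam • v) :
    ∃ c : ℂ, ∀ y : ℝ, ℓ (A[y] v) + (1 / (2 * κ)) * ℓ (A[y] (Lo v)) =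
      c * (Real.exp y : ℂ) ^ ((μ + 1) / 2) * besselMode a (Complex.I * (κ - 1 / 2)) (Real.exp y) := by
  have hW1 : D (X⁺ - X⁻) v = (Complex.I * 1) • v := by rwa [mul_one]
  -- the weight `-1` vector `u = τ(L) v`: weight, centre, `τ(R) u = 4κ² v`
  have hWu : D (X⁺ - X⁻) (Lo v) = (Complex.I * (-1)) • (Lo v) := by
    have h := rotGen_lowering_apply hτ w 1 v hW1
    rwa [show (1 : ℂ) - 2 = -1 by norm_num] at h
  have hZu : D H₀ (Lo v) + D H₁ (Lo v) = μ • (Lo v) := (center_lowering_raising_apply hτ w μ v hZ).1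
  have hRL : Ra (Lo v) = ((2 * κ) ^ 2) • v := by
    rw [raising_lowering_apply hτ w 1 μ lam v hW1 hZ hC, hκ]
    congr 1
    ring
  -- the functions
  set f : ℝ → ℂ := fun x => ℓ (A[x] v) with hfd
  set g : ℝ → ℂ := fun x => ℓ (A[x] (Lo v)) with hgd
  set α : ℂ := (μ + 1) / 2 with hαd
  set ε : ℂ := 1 / (2 * κ) with hεd
  have hεκ : ε * κ = 1 / 2 := by rw [hεd]; field_simp
  have hf' : ∀ y, HasDerivAt f ((α + Complex.I * θ * (Real.exp y : ℂ)) * f y + (1 / 2) * g y) y := fun y => by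
    have h := hasDerivAt_apply_gardingAct_expGL_lowering hτ w hℓ hθ 1 μ v hW1 hZ y
    refine h.congr_deriv ?_
    simp only [hfd, hgd, hαd]
  have hg' : ∀ y, HasDerivAt g ((α - Complex.I * θ * (Real.exp y : ℂ)) * g y + (2 * κ ^ 2) * f y) y := fun y => by
    have h := hasDerivAt_apply_gardingAct_expGL_raising hτ w hℓ hθ (-1) μ (Lo v) hWu hZu y
    rw [hRL, map_smul, map_smul, smul_eq_mul] at h
    refine h.congr_deriv ?_
    simp only [hfd, hgd, hαd]
    ring
  -- `h = f + ε g`, `j = f - ε g` solve `h' = (α+κ) h + iθe^y j`, `j' = (α-κ) j + iθe^y h`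
  set h : ℝ → ℂ := fun x => f x + ε * g x with hhd
  set j : ℝ → ℂ := fun x => f x - ε * g x with hjd
  have e1 : ε * (2 * κ ^ 2) = κ := by linear_combination (2 * κ) * hεκ
  have hh' : ∀ y, HasDerivAt h ((α + κ) * h y + Complex.I * θ * ((Real.exp y : ℂ) * j y)) y := fun y => by
    have hd := (hf' y).add ((hg' y).const_mul ε)
    refine hd.congr_deriv ?_
    simp only [hhd, hjd]
    linear_combination (f y) * e1 + (-(g y)) * hεκ
  have hj' : ∀ y, HasDerivAt j ((α - κ) * j y + Complex.I * θ * ((Real.exp y : ℂ) * h y)) y := fun y => by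
    have hd := (hf' y).sub ((hg' y).const_mul ε)
    refine hd.congr_deriv ?_
    simp only [hhd, hjd]
    linear_combination (-(f y)) * e1 + (-(g y)) * hεκ
  have hh₁' : ∀ y, HasDerivAt (fun x : ℝ => (α + κ) * h x + Complex.I * θ * ((Real.exp x : ℂ) * j x))
      ((α + κ) * ((α + κ) * h y + Complex.I * θ * ((Real.exp y : ℂ) * j y)) +
        Complex.I * θ * ((Real.exp y : ℂ) * j y + (Real.exp y : ℂ) * ((α - κ) * j y + Complex.I * θ * ((Real.exp y : ℂ) * h y)))) y :=
    fun y => ((hh' y).const_mul (α + κ)).add (((hasDerivAt_ofReal_exp y).mul (hj' y)).const_mul (Complex.I * θ))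
  -- eliminating `j`: the weight-zero equation for `h`
  have hode : ∀ y : ℝ,
      2 * ((α + κ) * ((α + κ) * h y + Complex.I * θ * ((Real.exp y : ℂ) * j y)) +
        Complex.I * θ * ((Real.exp y : ℂ) * j y + (Real.exp y : ℂ) * ((α - κ) * j y + Complex.I * θ * ((Real.exp y : ℂ) * h y)))) -
      (2 * (μ + 1) + 2) * ((α + κ) * h y + Complex.I * θ * ((Real.exp y : ℂ) * j y)) +
      (2 * (1 + α - κ) * (α + κ)) * h y + 2 * θ ^ 2 * (Real.exp y : ℂ) ^ 2 * h y = 0 := fun y => by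
    linear_combination (4 * (α + κ) * h y + 4 * Complex.I * θ * (Real.exp y : ℂ) * j y) * hαd +
      (2 * θ ^ 2 * (Real.exp y : ℂ) ^ 2 * h y) * Complex.I_sq
  -- growth of `h`
  obtain ⟨M₁, N₁, hM₁, hb₁⟩ := exists_norm_apply_gardingAct_expGL_le hτ w hτb hℓ v
  obtain ⟨M₂, N₂, hM₂, hb₂⟩ := exists_norm_apply_gardingAct_expGL_le hτ w hτb hℓ (Lo v)
  have hgrow : ∀ y : ℝ, 0 ≤ y → ‖h y‖ ≤ (M₁ + ‖ε‖ * M₂) * Real.exp (((N₁ + N₂ : ℕ) : ℝ) * y) := fun y hy => by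
    have b1 := hb₁ y
    have b2 := hb₂ y
    rw [abs_of_nonneg hy] at b1 b2
    have hN1 : Real.exp ((N₁ : ℝ) * y) ≤ Real.exp (((N₁ + N₂ : ℕ) : ℝ) * y) :=
      Real.exp_le_exp.2 (by push_cast; nlinarith)
    have hN2 : Real.exp ((N₂ : ℝ) * y) ≤ Real.exp (((N₁ + N₂ : ℕ) : ℝ) * y) :=
      Real.exp_le_exp.2 (by push_cast; nlinarith)
    calc ‖h y‖ = ‖f y + ε * g y‖ := rfl
      _ ≤ ‖f y‖ + ‖ε‖ * ‖g y‖ := (norm_add_le _ _).trans (by rw [norm_mul])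
      _ ≤ M₁ * Real.exp ((N₁ : ℝ) * y) + ‖ε‖ * (M₂ * Real.exp ((N₂ : ℝ) * y)) := by
          gcongr
      _ ≤ M₁ * Real.exp (((N₁ + N₂ : ℕ) : ℝ) * y) + ‖ε‖ * (M₂ * Real.exp (((N₁ + N₂ : ℕ) : ℝ) * y)) := by
          gcongr
      _ = (M₁ + ‖ε‖ * M₂) * Real.exp (((N₁ + N₂ : ℕ) : ℝ) * y) := by ring
  have hw : (Complex.I * (κ - 1 / 2)) ^ 2 + 1 / 4 =
      (2 * (1 + α - κ) * (α + κ)) / 2 - (μ + 1) ^ 2 / 4 - (μ + 1) / 2 := by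
    linear_combination ((κ - 1 / 2) ^ 2) * Complex.I_sq + (-(α + (μ + 1) / 2 + 1)) * hαd
  obtain ⟨c, hc⟩ := exists_eq_const_mul_exp_mul_besselMode_of_growth (f := h)
    (f₁ := fun y : ℝ => (α + κ) * h y + Complex.I * θ * ((Real.exp y : ℂ) * j y))
    (f₂ := fun y : ℝ => (α + κ) * ((α + κ) * h y + Complex.I * θ * ((Real.exp y : ℂ) * j y)) +
      Complex.I * θ * ((Real.exp y : ℂ) * j y + (Real.exp y : ℂ) * ((α - κ) * j y + Complex.I * θ * ((Real.exp y : ℂ) * h y))))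
    hh' hh₁' ha hθa hode hgrow (Complex.I * (κ - 1 / 2)) hw
  exact ⟨c, fun y => hc y⟩

/-- **… and the Mellin transform**: for `re(S + (μ+1)/2) > |im(i(κ - ½))|`,
`∫₀^∞ h(log u) u^{S - 1/2} du/u = c · 2 a^{-(S+(μ+1)/2)} 2^{S+(μ+1)/2-2} Γ(½(S + (μ+1)/2 - (κ - ½))) Γ(½(S + (μ+1)/2 + (κ - ½)))`
(`integral_cpow_mul_besselMode`; a single product of two Gamma functions). [cite: JacquetLanglands1970, §5, Thm. 5.15 and Prop. 5.17] -/
theorem exists_weightOne_combination_eq_besselMode_and_mellin (hτb : ∀ g, ‖(τ g : E →L[ℂ] E)‖ ≤ 1)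
    {ℓ : archGardingSpace hcpt τ →ₗ[ℂ] ℂ}
    (hℓ : ∃ (C : ℝ) (𝒮 : Finset (List (Matrix (Fin 2) (Fin 2) (mixedSpace K)))), 0 ≤ C ∧
      ∀ v : archGardingSpace hcpt τ, ‖ℓ v‖ ≤ C * ∑ w ∈ 𝒮, ‖archWordDerivE hcpt τ w v‖)
    {θ : ℂ} (hθ : ∀ u : archGardingSpace hcpt τ, ℓ (D X⁺ u) = θ * ℓ u)
    {a : ℝ} (ha : 0 < a) (hθa : θ ^ 2 = -((a : ℂ) ^ 2))
    (μ lam κ : ℂ) (hκ : (2 * κ) ^ 2 = 2 * lam - μ ^ 2 + 1) (hκ0 : κ ≠ 0) (v : archGardingSpace hcpt τ)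
    (hW : D (X⁺ - X⁻) v = Complex.I • v) (hZ : D H₀ v + D H₁ v = μ • v)
    (hC : ∑ i : Fin 2, ∑ j : Fin 2, D (Matrix.single i j ((Pi.single w 1, 0) : mixedSpace K))
        (D (Matrix.single j i ((Pi.single w 1, 0) : mixedSpace K)) v) = lam • v) :
    ∃ c : ℂ, (∀ y : ℝ, ℓ (A[y] v) + (1 / (2 * κ)) * ℓ (A[y] (Lo v)) =
        c * (Real.exp y : ℂ) ^ ((μ + 1) / 2) * besselMode a (Complex.I * (κ - 1 / 2)) (Real.exp y)) ∧
      ∀ S : ℂ, |(Complex.I * (κ - 1 / 2)).im| < (S + (μ + 1) / 2).re →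
        ∫ u in Ioi (0 : ℝ), (ℓ (A[Real.log u] v) + (1 / (2 * κ)) * ℓ (A[Real.log u] (Lo v))) * (u : ℂ) ^ (S - 1 / 2 - 1) =
          c * (2 * ((a : ℂ) ^ (-(S + (μ + 1) / 2)) * ((2 : ℂ) ^ (S + (μ + 1) / 2 - 2) *
            Complex.Gamma ((S + (μ + 1) / 2 + Complex.I * (Complex.I * (κ - 1 / 2))) / 2) *
              Complex.Gamma ((S + (μ + 1) / 2 - Complex.I * (Complex.I * (κ - 1 / 2))) / 2)))) := by
  obtain ⟨c, hc⟩ := exists_weightOne_combination_eq_besselMode hτ w hτb hℓ hθ ha hθa μ lam κ hκ hκ0 v hW hZ hC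
  refine ⟨c, hc, fun S hS => ?_⟩
  rw [← integral_cpow_mul_besselMode ha hS, ← MeasureTheory.integral_const_mul]
  refine setIntegral_congr_fun measurableSet_Ioi fun u hu => ?_
  rw [hc (Real.log u), Real.exp_log hu]
  ring

end ODE

end Literature.NumberTheory.Automorphic
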